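import Mathlib
import HarnessLib
import Summits.NavierStokesRegularity.NavierStokesRegularity.Theses.PoloidalWindowDoor
import Summits.NavierStokesRegularity.NavierStokesRegularity.Theorems.PoloidalWindowDoorPoloidalWindowRigiditySharper
import Summits.NavierStokesRegularity.NavierStokesRegularity.Theorems.PoloidalWindowDoorPoloidalWindowRigidityK2OfLrcSpatial
import Summits.NavierStokesRegularity.NavierStokesRegularity.Theorems.PoloidalWindowDoorPoloidalWindowRigidityHorizontalFlatPast
import Summits.NavierStokesRegularity.NavierStokesRegularity.Theorems.PoloidalWindowDoorPoloidalWindowRigidityEntireGerm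
import Summits.NavierStokesRegularity.NavierStokesRegularity.Theorems.PoloidalWindowDoorPoloidalWindowRigidityTimeShearLiminf
import Summits.NavierStokesRegularity.NavierStokesRegularity.Theorems.PoloidalWindowDoorPoloidalWindowRigidityK2OfLrcSlope
import Summits.NavierStokesRegularity.NavierStokesRegularity.Theorems.PoloidalWindowDoorPoloidalWindowRigidityStubUntwisted
import Summits.NavierStokesRegularity.NavierStokesRegularity.Theorems.PoloidalWindowDoorPoloidalWindowRigidityThmAThreeStubs
import Summits.NavierStokesRegularity.NavierStokesRegularity.Theorems.PoloidalWindowDoorPoloidalWindowRigidityThickStubsOfLocalEmpty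
import Literature.Analysis.FluidPDE.OseenMildUniqueness
import Literature.Analysis.FluidPDE.OseenZoomCovariance

/-!
# SKELETON `congruence_door` (v1) — crux `PoloidalWindowRigidity` (K2, stmt-NavierStokesRegularity-19708), route `PoloidalWindowDoor`
# (crux-strategist cstrat-19708 g4, 2026-08-28)

THE MOVE.  Every registered line on this crux (`lrc_jet` v5, `mixed_type` v2, `local_rigidity` v1; 20428's `twist_split`) closes
its research stubs in ONE currency: LOCAL EMPTINESS of the twisting strata (`hemptyHyp`, `hempty_thick` — exact-elimination
certificates, cert-1 / K2-p4 / K2-p5 / nsreg-p7).  nsreg-p7 g12 RESULT 2 leaves a live contingency in which that currency is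
void: a consistent STEADY twisting (TH) jet stratum `V₀` next to the crossed suction layers.  If steady (or rigidly moving)
twisting germs exist, emptiness is false and all registered (TH) columns die together — yet such germs are HARMLESS for the
crux, by a class lemma nobody had typed:

* **G0, the CONGRUENCE DOOR** (`stub_congruenceDoor`; TRUE, M-sized, every input already in the tree): a Type-I ancient mild
  profile two of whose slices `s < t < 0` are congruent by a Euclidean motion on SOME nonempty open set,
  `v(t, x) = A v(s, A⁻¹(x − b))`, is bounded up to the apex, hence not backward-singular.  Proof: slice analyticity globalises
  the congruence in `x`; FORWARD uniqueness of bounded mild solutions (`Literature.Analysis.FluidPDE.oseenMild_bounded_unique`)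
  applied to the time-translate `v(·+δ)`, `δ = t − s`, and the push-forward `A v(·, A⁻¹(· − b))` (a mild solution with the same
  free part, by the tree's covariance lemmas `oseenDuhamel_translate`, `oseenDuhamel_comp_add_right`,
  `oseenDuhamel_symm_conj_linearIsometryEquiv`, `heatExtension_comp_add_right`, `heatExtension_conj_linearIsometryEquiv`)
  globalises it in time up to `0⁻`; so `sup|v(τ)|` is `δ`-periodic, bounded by the Type-I bound on one period.  No backward
  uniqueness, no decay, no structure hypothesis.

So the research residue is RE-TYPED STRICTLY WEAKER: not «the twisting strata are EMPTY» but «a class profile with a twisting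
window has two congruent slices» (G1 hyperbolic-(TH), G2 hyperbolic-thick, G3 semi-elliptic-slab thick — binders VERBATIM
`mixed_type` v2's three stubs, conclusion weakened to G0's hypothesis).  Emptiness certificates still close G1–G3 (their
hypotheses become inconsistent); the steady / travelling / rotating contingency ALSO satisfies them; only a GENUINELY UNSTEADY
twisting germ in the class defeats them — and none is known in any stratum (the unsteady (TH) families of the tree, K2-p2's
F1/F2, are untwisted; refuter1's strained crossed suction layers have time-only slope, excluded by the pin; thick: nothing).
Engines: «unsteady modulo Euclidean motions» is an elimination problem with four extra CONSTANT unknowns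
(`∂ₜu = (c + Ωe₃×x)·∇u − Ωe₃×u`), cheaper than full emptiness because the steady variety need not be excluded.

Composition (kernel-checked below): `mixed_type` stubs ⇐ G0 + Gk (one line each) ⇒ `lrc_jet` v5 `stub_twisting` by the tree
theorem `…ThmAThreeStubs.twisting_regular_of_three` (p581287) ⇒ with the tree theorem `…StubUntwisted.stub_untwisted` (p561151)
the `lrc_jet` v5 chain VERBATIM (`ndRegular` → `lrcSpatial_of_stubs` → `tv_of_stubs` → `…K2OfLrcSpatial.nonflatLiouville_of_lrc_spatial`
→ `…Sharper.poloidalWindowRigidity_of_sliceSharpNonflatLiouville`) ⇒ `PoloidalWindowRigidity_of_congruenceDoor`.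
Sorries: exactly the four `stub_*` (G0 provable now; G1–G3 research, each strictly weaker than the corresponding mixed_type stub
given G0).  Disproof classes honoured (crux `Disproof.lean` §C/§K): `…Negative.poloidalWindowRigidity_false_without_mild`,
`twisting_false_without_mild[_frozen_analytic]`, `twistingTH_false_without_mild`, `semiEllipticThick_false_without_mild` — G0 uses
(M) twice, G1–G3 keep (M) and every pin of the refuted weakenings (twist ≠ 0, (TV)-pin, type sign / thickness).
WHAT THIS IS NOT: not a proof of K2, not a claim about Navier–Stokes regularity — a registered decomposition with one provable
door and three research stubs; nothing about Clay (A).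
-/

-- the summit and its single sub-problem share the name (CONVENTIONS §1)
set_option linter.dupNamespace false

namespace Summit.NavierStokesRegularity.NavierStokesRegularity.Cruxes.PoloidalWindowRigidity.CongruenceDoor

open Set Function
open scoped RealInnerProductSpace InnerProductSpace
open Literature.Analysis Literature.Analysis.FluidPDE
open Summit.NavierStokesRegularity.NavierStokesRegularity.Theorems.PoloidalWindowDoorPoloidalWindowRigiditySharper
open Summit.NavierStokesRegularity.NavierStokesRegularity.Theorems.PoloidalWindowDoorPoloidalWindowRigidityK2OfLrcSpatial
open Summit.NavierStokesRegularity.NavierStokesRegularity.Theorems.PoloidalWindowDoorPoloidalWindowRigidityHorizontalFlatPast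
open Summit.NavierStokesRegularity.NavierStokesRegularity.Theorems.PoloidalWindowDoorPoloidalWindowRigidityEntireGerm
open Summit.NavierStokesRegularity.NavierStokesRegularity.Theorems.PoloidalWindowDoorPoloidalWindowRigidityK2OfLrcSlope
open Summit.NavierStokesRegularity.NavierStokesRegularity.Theorems.TubeAlternative.AnalyticPropagation
open Summit.NavierStokesRegularity.NavierStokesRegularity.Theorems.PoloidalWindowDoorPoloidalWindowRigidityThmAThreeStubs

/-! ### The four registered stubs -/

/-- **STUB G0 — THE CONGRUENCE DOOR (class lemma; provable now from tree facts, M-sized).**  A profile of the route's Type-I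
ancient mild class two of whose slices are CONGRUENT on an open set — `v(t, x) = A v(s, A⁻¹(x − b))` for `x` in a nonempty open
`O ⊆ ℝ³`, for some `s < t < 0` and some Euclidean motion `x ↦ A x + b` (`A` a linear isometry) — is not backward-singular at the
apex.  Covers every STEADY, TRAVELLING-WAVE, ROTATING-WAVE or SCREW-PERIODIC germ (take `A = 1, b = (t−s)c`, resp. a rotation).
Mechanism (structure-blind: no poloidality, no decay, no backward uniqueness): (1) slices of class profiles are real-analytic on
`ℝ³` (`…AnalyticPropagation.analyticOnNhd_uncurry`), so the congruence holds for ALL `x`; (2) with `δ = t − s > 0`, the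
time-translate `τ ↦ v(τ+δ)` and the pushed-forward profile `τ ↦ A v(τ, A⁻¹(· − b))` are bounded, continuous mild solutions on
`(s, T)` (every `T < −δ`) with the SAME free part `e^{(τ−s)Δ} v(t)` — by `oseenDuhamel_translate` (time covariance),
`oseenDuhamel_comp_add_right` + `oseenDuhamel_symm_conj_linearIsometryEquiv` and `heatExtension_comp_add_right` +
`heatExtension_conj_linearIsometryEquiv` (Euclidean covariance), all in `Literature.Analysis.FluidPDE` — and they agree at `τ = s`;
FORWARD uniqueness of bounded mild solutions (`Literature.Analysis.FluidPDE.oseenMild_bounded_unique`) gives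
`v(τ+δ) = A v(τ, A⁻¹(· − b))` for all `τ ∈ (s, −δ)`; (3) hence `N(τ) = sup|v(τ, ·)|` is `δ`-periodic on `(s, 0)`, so
`N ≤ C/√(−t)` on `(s, 0)` by the Type-I bound on one period; (4) `v` is continuous and bounded on the parabolic cylinder
`Q_r(0,0) = (−r², 0) × B_r`, `r² ≤ −s`, so `‖v‖_{L^∞(Q_r)} < ∞`: `¬ IsBackwardSingularPoint v 0`.
Honours refuter1's `…Negative.poloidalWindowRigidity_false_without_mild` / `twisting_false_without_mild`: the door USES (M)
(mildness) twice — analyticity and forward uniqueness. [folklore] -/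
theorem stub_congruenceDoor :
    ∀ (C : ℝ) (v : ℝ → EuclideanSpace ℝ (Fin 3) → EuclideanSpace ℝ (Fin 3)),
      Literature.Analysis.FluidPDE.HasTypeITimeDecay C v →
      ContinuousOn (Function.uncurry v) (Set.Iio (0 : ℝ) ×ˢ Set.univ) →
      (∀ s t : ℝ, s < t → t < 0 → ∀ x, v t x =
        Literature.Analysis.UnboundedOperators.heatExtension (v s) (t - s) x -
          Literature.Analysis.FluidPDE.oseenDuhamel 1 s v v t x) →
      (∃ s t : ℝ, s < t ∧ t < 0 ∧
          ∃ (A : EuclideanSpace ℝ (Fin 3) ≃ₗᵢ[ℝ] EuclideanSpace ℝ (Fin 3)) (b : EuclideanSpace ℝ (Fin 3))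
            (O : Set (EuclideanSpace ℝ (Fin 3))), IsOpen O ∧ O.Nonempty ∧ ∀ x ∈ O, v t x = A (v s (A.symm (x - b)))) →
      ¬ Literature.Analysis.FluidPDE.IsBackwardSingularPoint v 0 := by
  sorry

/-- **STUB G1 — CONGRUENCE RIGIDITY ON THE HYPERBOLIC (TH) TWISTING STRATUM (the research residue, re-typed STRICTLY WEAKER).**
VERBATIM the hypotheses of `mixed_type` v2's `stub_hyperbolicTH` (class, poloidal along `e₃`, a nonempty open window `W` of the
backward slab which is non-degenerate, carries the (TV)-pin «the shear slope is a function of `t` alone on no open sub-window»,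
is TWISTING, HYPERBOLIC (`∂₂v₀·∂₀v₂ + ∂₂v₁·∂₁v₂ < 0`) and (TH) (slope a function of `(t, x₂)`)), with the conclusion WEAKENED from
«regular» to «two slices `s < t < 0` of `v` are congruent on a nonempty open set» (the hypothesis of the door G0).  Strictly
weaker than local EMPTINESS of the stratum (`hemptyHyp` of `…LrcModEntireTwistingTHLocalHyp`, which closes `stub_hyperbolicTH` by
name: an emptiness certificate makes the present hypotheses inconsistent); but G1 ALSO survives the contingency left open by
nsreg-p7 g12 RESULT 2 — a consistent STEADY twisting (TH) jet stratum `V₀` next to the crossed suction layers: steady,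
travelling or rotating germs give congruent slices.  What G1 excludes is a GENUINELY UNSTEADY (no two slices congruent)
twisting hyperbolic (TH) profile in the class; none is known.  Every pin is load-bearing: refuter1's strained crossed suction
layers (slope `−s²e^{−6t}`, genuinely unsteady) have time-only slope — excluded by the (TV)-pin; K2-p2's (TH) families F1/F2
(free time-dependence) are untwisted — excluded by the twist hypothesis; and (M) is kept (`twistingTH_false_without_mild`).
Engine handle: «unsteady modulo Euclidean motions» — adjoin the infinitesimal version `∂ₜu = (c + Ωe₃×x)·∇u − Ωe₃×u`
(4 unknown CONSTANTS) to cert-1's (TH)∩twisting hierarchy instead of excluding the whole steady variety. -/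
theorem stub_congruentHyperbolicTH :
    ∀ (C : ℝ) (v : ℝ → EuclideanSpace ℝ (Fin 3) → EuclideanSpace ℝ (Fin 3)),
      Literature.Analysis.FluidPDE.HasTypeITimeDecay C v →
      ContinuousOn (Function.uncurry v) (Set.Iio (0 : ℝ) ×ˢ Set.univ) →
      (∀ s t : ℝ, s < t → t < 0 → ∀ x, v t x =
        Literature.Analysis.UnboundedOperators.heatExtension (v s) (t - s) x -
          Literature.Analysis.FluidPDE.oseenDuhamel 1 s v v t x) →
      (∀ t < 0, Literature.Analysis.FluidPDE.VectorCalculus.IsDivFree (v t)) →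
      (∀ s < 0, ∀ y, ⟪Literature.Analysis.FluidPDE.curl (v s) y, EuclideanSpace.single 2 1⟫_ℝ = 0) →
      ∀ W : Set (ℝ × EuclideanSpace ℝ (Fin 3)), IsOpen W → W.Nonempty → W ⊆ Set.Iio (0 : ℝ) ×ˢ Set.univ →
        (∀ z ∈ W, Literature.Analysis.FluidPDE.curl (v z.1) z.2 ≠ 0 ∧
          (fderiv ℝ (v z.1) z.2 (EuclideanSpace.single 0 1) 2 ≠ 0 ∨ fderiv ℝ (v z.1) z.2 (EuclideanSpace.single 1 1) 2 ≠ 0) ∧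
          (fderiv ℝ (v z.1) z.2 (EuclideanSpace.single 2 1) 0 ≠ 0 ∨ fderiv ℝ (v z.1) z.2 (EuclideanSpace.single 2 1) 1 ≠ 0)) →
        (∀ m : ℝ → ℝ, ∀ W₁ : Set (ℝ × EuclideanSpace ℝ (Fin 3)), W₁ ⊆ W → IsOpen W₁ → W₁.Nonempty →
          ∃ z ∈ W₁, ∃ b : Fin 3, b ≠ 2 ∧
            fderiv ℝ (v z.1) z.2 (EuclideanSpace.single 2 1) b ≠
              m z.1 * fderiv ℝ (v z.1) z.2 (EuclideanSpace.single b 1) 2) →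
        (∀ z ∈ W,
          fderiv ℝ (fun x => fderiv ℝ (v z.1) x (EuclideanSpace.single 2 1) 2) z.2 (EuclideanSpace.single 0 1) *
              fderiv ℝ (v z.1) z.2 (EuclideanSpace.single 1 1) 2 -
            fderiv ℝ (fun x => fderiv ℝ (v z.1) x (EuclideanSpace.single 2 1) 2) z.2 (EuclideanSpace.single 1 1) *
              fderiv ℝ (v z.1) z.2 (EuclideanSpace.single 0 1) 2 ≠ 0) →
        (∀ z ∈ W,
          fderiv ℝ (v z.1) z.2 (EuclideanSpace.single 2 1) 0 * fderiv ℝ (v z.1) z.2 (EuclideanSpace.single 0 1) 2 +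
            fderiv ℝ (v z.1) z.2 (EuclideanSpace.single 2 1) 1 * fderiv ℝ (v z.1) z.2 (EuclideanSpace.single 1 1) 2 < 0) →
        (∃ m : ℝ → ℝ → ℝ, ∀ z ∈ W, ∀ b : Fin 3, b ≠ 2 →
          fderiv ℝ (v z.1) z.2 (EuclideanSpace.single 2 1) b =
            m z.1 (z.2 2) * fderiv ℝ (v z.1) z.2 (EuclideanSpace.single b 1) 2) →
        ∃ s t : ℝ, s < t ∧ t < 0 ∧
          ∃ (A : EuclideanSpace ℝ (Fin 3) ≃ₗᵢ[ℝ] EuclideanSpace ℝ (Fin 3)) (b : EuclideanSpace ℝ (Fin 3))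
            (O : Set (EuclideanSpace ℝ (Fin 3))), IsOpen O ∧ O.Nonempty ∧ ∀ x ∈ O, v t x = A (v s (A.symm (x - b))) := by
  sorry

/-- **STUB G2 — CONGRUENCE RIGIDITY ON THE HYPERBOLIC THICK TWISTING STRATUM.**  VERBATIM the hypotheses of `mixed_type` v2's
`stub_hyperbolicThick` (as G1 but, instead of (TH), the THICKNESS clause: the slope is a function of `(t, x₂)` on no open
sub-window), conclusion weakened to «two slices `s < t < 0` congruent on a nonempty open set».  Strictly weaker than
`hempty_thick` (`…ThickStubsOfLocalEmpty.stub_hyperbolicThick_of_localEmptyThick` closes the mixed_type stub from emptiness);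
no thick poloidal NS germ is known at all (K2-p5: helical / conical / oblique-2.5D classes numerically EMPTY), and the only
candidates ever proposed (helical waves) are steady, translating or rotating — all congruent-sliced.
(M) kept (`semiEllipticThick_false_without_mild`, K-50/K-52 thick profiles are (M)-free). -/
theorem stub_congruentHyperbolicThick :
    ∀ (C : ℝ) (v : ℝ → EuclideanSpace ℝ (Fin 3) → EuclideanSpace ℝ (Fin 3)),
      Literature.Analysis.FluidPDE.HasTypeITimeDecay C v →
      ContinuousOn (Function.uncurry v) (Set.Iio (0 : ℝ) ×ˢ Set.univ) →
      (∀ s t : ℝ, s < t → t < 0 → ∀ x, v t x =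
        Literature.Analysis.UnboundedOperators.heatExtension (v s) (t - s) x -
          Literature.Analysis.FluidPDE.oseenDuhamel 1 s v v t x) →
      (∀ t < 0, Literature.Analysis.FluidPDE.VectorCalculus.IsDivFree (v t)) →
      (∀ s < 0, ∀ y, ⟪Literature.Analysis.FluidPDE.curl (v s) y, EuclideanSpace.single 2 1⟫_ℝ = 0) →
      ∀ W : Set (ℝ × EuclideanSpace ℝ (Fin 3)), IsOpen W → W.Nonempty → W ⊆ Set.Iio (0 : ℝ) ×ˢ Set.univ →
        (∀ z ∈ W, Literature.Analysis.FluidPDE.curl (v z.1) z.2 ≠ 0 ∧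
          (fderiv ℝ (v z.1) z.2 (EuclideanSpace.single 0 1) 2 ≠ 0 ∨ fderiv ℝ (v z.1) z.2 (EuclideanSpace.single 1 1) 2 ≠ 0) ∧
          (fderiv ℝ (v z.1) z.2 (EuclideanSpace.single 2 1) 0 ≠ 0 ∨ fderiv ℝ (v z.1) z.2 (EuclideanSpace.single 2 1) 1 ≠ 0)) →
        (∀ m : ℝ → ℝ, ∀ W₁ : Set (ℝ × EuclideanSpace ℝ (Fin 3)), W₁ ⊆ W → IsOpen W₁ → W₁.Nonempty →
          ∃ z ∈ W₁, ∃ b : Fin 3, b ≠ 2 ∧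
            fderiv ℝ (v z.1) z.2 (EuclideanSpace.single 2 1) b ≠
              m z.1 * fderiv ℝ (v z.1) z.2 (EuclideanSpace.single b 1) 2) →
        (∀ z ∈ W,
          fderiv ℝ (fun x => fderiv ℝ (v z.1) x (EuclideanSpace.single 2 1) 2) z.2 (EuclideanSpace.single 0 1) *
              fderiv ℝ (v z.1) z.2 (EuclideanSpace.single 1 1) 2 -
            fderiv ℝ (fun x => fderiv ℝ (v z.1) x (EuclideanSpace.single 2 1) 2) z.2 (EuclideanSpace.single 1 1) *
              fderiv ℝ (v z.1) z.2 (EuclideanSpace.single 0 1) 2 ≠ 0) →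
        (∀ z ∈ W,
          fderiv ℝ (v z.1) z.2 (EuclideanSpace.single 2 1) 0 * fderiv ℝ (v z.1) z.2 (EuclideanSpace.single 0 1) 2 +
            fderiv ℝ (v z.1) z.2 (EuclideanSpace.single 2 1) 1 * fderiv ℝ (v z.1) z.2 (EuclideanSpace.single 1 1) 2 < 0) →
        (∀ m : ℝ → ℝ → ℝ, ∀ W₁ : Set (ℝ × EuclideanSpace ℝ (Fin 3)), W₁ ⊆ W → IsOpen W₁ → W₁.Nonempty →
          ∃ z ∈ W₁, ∃ b : Fin 3, b ≠ 2 ∧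
            fderiv ℝ (v z.1) z.2 (EuclideanSpace.single 2 1) b ≠
              m z.1 (z.2 2) * fderiv ℝ (v z.1) z.2 (EuclideanSpace.single b 1) 2) →
        ∃ s t : ℝ, s < t ∧ t < 0 ∧
          ∃ (A : EuclideanSpace ℝ (Fin 3) ≃ₗᵢ[ℝ] EuclideanSpace ℝ (Fin 3)) (b : EuclideanSpace ℝ (Fin 3))
            (O : Set (EuclideanSpace ℝ (Fin 3))), IsOpen O ∧ O.Nonempty ∧ ∀ x ∈ O, v t x = A (v s (A.symm (x - b))) := by
  sorry

/-- **STUB G3 — CONGRUENCE RIGIDITY ON THE THICK TWISTING STRATUM INSIDE A SEMI-ELLIPTIC SLAB.**  VERBATIM the hypotheses of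
`mixed_type` v2's `stub_semiEllipticThick` (window inside a time-slab all of whose slices are semi-elliptic,
`∂₂v₀·∂₀v₂ + ∂₂v₁·∂₁v₂ ≥ 0` everywhere, plus the thickness clause), conclusion weakened to «two slices `s < t < 0` congruent on
a nonempty open set».  (The (TH) part of the semi-elliptic regime is Theorem A, tree
`…ThmASemiEllipticThick.semiElliptic_regular_of_thick`; only the thick part is a stub, as in mixed_type v2.) -/
theorem stub_congruentSemiEllipticThick :
    ∀ (C : ℝ) (v : ℝ → EuclideanSpace ℝ (Fin 3) → EuclideanSpace ℝ (Fin 3)),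
      Literature.Analysis.FluidPDE.HasTypeITimeDecay C v →
      ContinuousOn (Function.uncurry v) (Set.Iio (0 : ℝ) ×ˢ Set.univ) →
      (∀ s t : ℝ, s < t → t < 0 → ∀ x, v t x =
        Literature.Analysis.UnboundedOperators.heatExtension (v s) (t - s) x -
          Literature.Analysis.FluidPDE.oseenDuhamel 1 s v v t x) →
      (∀ t < 0, Literature.Analysis.FluidPDE.VectorCalculus.IsDivFree (v t)) →
      (∀ s < 0, ∀ y, ⟪Literature.Analysis.FluidPDE.curl (v s) y, EuclideanSpace.single 2 1⟫_ℝ = 0) →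
      ∀ W : Set (ℝ × EuclideanSpace ℝ (Fin 3)), IsOpen W → W.Nonempty → W ⊆ Set.Iio (0 : ℝ) ×ˢ Set.univ →
        (∀ z ∈ W, Literature.Analysis.FluidPDE.curl (v z.1) z.2 ≠ 0 ∧
          (fderiv ℝ (v z.1) z.2 (EuclideanSpace.single 0 1) 2 ≠ 0 ∨ fderiv ℝ (v z.1) z.2 (EuclideanSpace.single 1 1) 2 ≠ 0) ∧
          (fderiv ℝ (v z.1) z.2 (EuclideanSpace.single 2 1) 0 ≠ 0 ∨ fderiv ℝ (v z.1) z.2 (EuclideanSpace.single 2 1) 1 ≠ 0)) →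
        (∀ m : ℝ → ℝ, ∀ W₁ : Set (ℝ × EuclideanSpace ℝ (Fin 3)), W₁ ⊆ W → IsOpen W₁ → W₁.Nonempty →
          ∃ z ∈ W₁, ∃ b : Fin 3, b ≠ 2 ∧
            fderiv ℝ (v z.1) z.2 (EuclideanSpace.single 2 1) b ≠
              m z.1 * fderiv ℝ (v z.1) z.2 (EuclideanSpace.single b 1) 2) →
        (∀ z ∈ W,
          fderiv ℝ (fun x => fderiv ℝ (v z.1) x (EuclideanSpace.single 2 1) 2) z.2 (EuclideanSpace.single 0 1) *
              fderiv ℝ (v z.1) z.2 (EuclideanSpace.single 1 1) 2 -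
            fderiv ℝ (fun x => fderiv ℝ (v z.1) x (EuclideanSpace.single 2 1) 2) z.2 (EuclideanSpace.single 1 1) *
              fderiv ℝ (v z.1) z.2 (EuclideanSpace.single 0 1) 2 ≠ 0) →
        ∀ a b : ℝ, W ⊆ Set.Ioo a b ×ˢ Set.univ →
          (∀ s ∈ Set.Ioo a b, ∀ y : EuclideanSpace ℝ (Fin 3),
            0 ≤ fderiv ℝ (v s) y (EuclideanSpace.single 2 1) 0 * fderiv ℝ (v s) y (EuclideanSpace.single 0 1) 2 +
              fderiv ℝ (v s) y (EuclideanSpace.single 2 1) 1 * fderiv ℝ (v s) y (EuclideanSpace.single 1 1) 2) →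
        (∀ m : ℝ → ℝ → ℝ, ∀ W₁ : Set (ℝ × EuclideanSpace ℝ (Fin 3)), W₁ ⊆ W → IsOpen W₁ → W₁.Nonempty →
          ∃ z ∈ W₁, ∃ b : Fin 3, b ≠ 2 ∧
            fderiv ℝ (v z.1) z.2 (EuclideanSpace.single 2 1) b ≠
              m z.1 (z.2 2) * fderiv ℝ (v z.1) z.2 (EuclideanSpace.single b 1) 2) →
        ∃ s t : ℝ, s < t ∧ t < 0 ∧
          ∃ (A : EuclideanSpace ℝ (Fin 3) ≃ₗᵢ[ℝ] EuclideanSpace ℝ (Fin 3)) (b : EuclideanSpace ℝ (Fin 3))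
            (O : Set (EuclideanSpace ℝ (Fin 3))), IsOpen O ∧ O.Nonempty ∧ ∀ x ∈ O, v t x = A (v s (A.symm (x - b))) := by
  sorry

/-! ### Composition, layer 1 (proved): the three `mixed_type` v2 stubs from the door and the three rigidity stubs -/

/-- `mixed_type` v2 `stub_hyperbolicTH`, VERBATIM, from G0 + G1. -/
theorem hyperbolicTH_of_door :
    ∀ (C : ℝ) (v : ℝ → EuclideanSpace ℝ (Fin 3) → EuclideanSpace ℝ (Fin 3)),
      Literature.Analysis.FluidPDE.HasTypeITimeDecay C v →
      ContinuousOn (Function.uncurry v) (Set.Iio (0 : ℝ) ×ˢ Set.univ) →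
      (∀ s t : ℝ, s < t → t < 0 → ∀ x, v t x =
        Literature.Analysis.UnboundedOperators.heatExtension (v s) (t - s) x -
          Literature.Analysis.FluidPDE.oseenDuhamel 1 s v v t x) →
      (∀ t < 0, Literature.Analysis.FluidPDE.VectorCalculus.IsDivFree (v t)) →
      (∀ s < 0, ∀ y, ⟪Literature.Analysis.FluidPDE.curl (v s) y, EuclideanSpace.single 2 1⟫_ℝ = 0) →
      ∀ W : Set (ℝ × EuclideanSpace ℝ (Fin 3)), IsOpen W → W.Nonempty → W ⊆ Set.Iio (0 : ℝ) ×ˢ Set.univ →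
        (∀ z ∈ W, Literature.Analysis.FluidPDE.curl (v z.1) z.2 ≠ 0 ∧
          (fderiv ℝ (v z.1) z.2 (EuclideanSpace.single 0 1) 2 ≠ 0 ∨ fderiv ℝ (v z.1) z.2 (EuclideanSpace.single 1 1) 2 ≠ 0) ∧
          (fderiv ℝ (v z.1) z.2 (EuclideanSpace.single 2 1) 0 ≠ 0 ∨ fderiv ℝ (v z.1) z.2 (EuclideanSpace.single 2 1) 1 ≠ 0)) →
        (∀ m : ℝ → ℝ, ∀ W₁ : Set (ℝ × EuclideanSpace ℝ (Fin 3)), W₁ ⊆ W → IsOpen W₁ → W₁.Nonempty →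
          ∃ z ∈ W₁, ∃ b : Fin 3, b ≠ 2 ∧
            fderiv ℝ (v z.1) z.2 (EuclideanSpace.single 2 1) b ≠
              m z.1 * fderiv ℝ (v z.1) z.2 (EuclideanSpace.single b 1) 2) →
        (∀ z ∈ W,
          fderiv ℝ (fun x => fderiv ℝ (v z.1) x (EuclideanSpace.single 2 1) 2) z.2 (EuclideanSpace.single 0 1) *
              fderiv ℝ (v z.1) z.2 (EuclideanSpace.single 1 1) 2 -
            fderiv ℝ (fun x => fderiv ℝ (v z.1) x (EuclideanSpace.single 2 1) 2) z.2 (EuclideanSpace.single 1 1) *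
              fderiv ℝ (v z.1) z.2 (EuclideanSpace.single 0 1) 2 ≠ 0) →
        (∀ z ∈ W,
          fderiv ℝ (v z.1) z.2 (EuclideanSpace.single 2 1) 0 * fderiv ℝ (v z.1) z.2 (EuclideanSpace.single 0 1) 2 +
            fderiv ℝ (v z.1) z.2 (EuclideanSpace.single 2 1) 1 * fderiv ℝ (v z.1) z.2 (EuclideanSpace.single 1 1) 2 < 0) →
        (∃ m : ℝ → ℝ → ℝ, ∀ z ∈ W, ∀ b : Fin 3, b ≠ 2 →
          fderiv ℝ (v z.1) z.2 (EuclideanSpace.single 2 1) b =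
            m z.1 (z.2 2) * fderiv ℝ (v z.1) z.2 (EuclideanSpace.single b 1) 2) →
        ¬ Literature.Analysis.FluidPDE.IsBackwardSingularPoint v 0 := by
  intro C v hrate hcont hmild hdiv hpol W hW hWne hWs hnd hpin htw hhyp hTH
  exact stub_congruenceDoor C v hrate hcont hmild
    (stub_congruentHyperbolicTH C v hrate hcont hmild hdiv hpol W hW hWne hWs hnd hpin htw hhyp hTH)

/-- `mixed_type` v2 `stub_hyperbolicThick`, VERBATIM, from G0 + G2. -/
theorem hyperbolicThick_of_door :
    ∀ (C : ℝ) (v : ℝ → EuclideanSpace ℝ (Fin 3) → EuclideanSpace ℝ (Fin 3)),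
      Literature.Analysis.FluidPDE.HasTypeITimeDecay C v →
      ContinuousOn (Function.uncurry v) (Set.Iio (0 : ℝ) ×ˢ Set.univ) →
      (∀ s t : ℝ, s < t → t < 0 → ∀ x, v t x =
        Literature.Analysis.UnboundedOperators.heatExtension (v s) (t - s) x -
          Literature.Analysis.FluidPDE.oseenDuhamel 1 s v v t x) →
      (∀ t < 0, Literature.Analysis.FluidPDE.VectorCalculus.IsDivFree (v t)) →
      (∀ s < 0, ∀ y, ⟪Literature.Analysis.FluidPDE.curl (v s) y, EuclideanSpace.single 2 1⟫_ℝ = 0) →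
      ∀ W : Set (ℝ × EuclideanSpace ℝ (Fin 3)), IsOpen W → W.Nonempty → W ⊆ Set.Iio (0 : ℝ) ×ˢ Set.univ →
        (∀ z ∈ W, Literature.Analysis.FluidPDE.curl (v z.1) z.2 ≠ 0 ∧
          (fderiv ℝ (v z.1) z.2 (EuclideanSpace.single 0 1) 2 ≠ 0 ∨ fderiv ℝ (v z.1) z.2 (EuclideanSpace.single 1 1) 2 ≠ 0) ∧
          (fderiv ℝ (v z.1) z.2 (EuclideanSpace.single 2 1) 0 ≠ 0 ∨ fderiv ℝ (v z.1) z.2 (EuclideanSpace.single 2 1) 1 ≠ 0)) →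
        (∀ m : ℝ → ℝ, ∀ W₁ : Set (ℝ × EuclideanSpace ℝ (Fin 3)), W₁ ⊆ W → IsOpen W₁ → W₁.Nonempty →
          ∃ z ∈ W₁, ∃ b : Fin 3, b ≠ 2 ∧
            fderiv ℝ (v z.1) z.2 (EuclideanSpace.single 2 1) b ≠
              m z.1 * fderiv ℝ (v z.1) z.2 (EuclideanSpace.single b 1) 2) →
        (∀ z ∈ W,
          fderiv ℝ (fun x => fderiv ℝ (v z.1) x (EuclideanSpace.single 2 1) 2) z.2 (EuclideanSpace.single 0 1) *
              fderiv ℝ (v z.1) z.2 (EuclideanSpace.single 1 1) 2 -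
            fderiv ℝ (fun x => fderiv ℝ (v z.1) x (EuclideanSpace.single 2 1) 2) z.2 (EuclideanSpace.single 1 1) *
              fderiv ℝ (v z.1) z.2 (EuclideanSpace.single 0 1) 2 ≠ 0) →
        (∀ z ∈ W,
          fderiv ℝ (v z.1) z.2 (EuclideanSpace.single 2 1) 0 * fderiv ℝ (v z.1) z.2 (EuclideanSpace.single 0 1) 2 +
            fderiv ℝ (v z.1) z.2 (EuclideanSpace.single 2 1) 1 * fderiv ℝ (v z.1) z.2 (EuclideanSpace.single 1 1) 2 < 0) →
        (∀ m : ℝ → ℝ → ℝ, ∀ W₁ : Set (ℝ × EuclideanSpace ℝ (Fin 3)), W₁ ⊆ W → IsOpen W₁ → W₁.Nonempty →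
          ∃ z ∈ W₁, ∃ b : Fin 3, b ≠ 2 ∧
            fderiv ℝ (v z.1) z.2 (EuclideanSpace.single 2 1) b ≠
              m z.1 (z.2 2) * fderiv ℝ (v z.1) z.2 (EuclideanSpace.single b 1) 2) →
        ¬ Literature.Analysis.FluidPDE.IsBackwardSingularPoint v 0 := by
  intro C v hrate hcont hmild hdiv hpol W hW hWne hWs hnd hpin htw hhyp hthick
  exact stub_congruenceDoor C v hrate hcont hmild
    (stub_congruentHyperbolicThick C v hrate hcont hmild hdiv hpol W hW hWne hWs hnd hpin htw hhyp hthick)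

/-- `mixed_type` v2 `stub_semiEllipticThick`, VERBATIM, from G0 + G3. -/
theorem semiEllipticThick_of_door :
    ∀ (C : ℝ) (v : ℝ → EuclideanSpace ℝ (Fin 3) → EuclideanSpace ℝ (Fin 3)),
      Literature.Analysis.FluidPDE.HasTypeITimeDecay C v →
      ContinuousOn (Function.uncurry v) (Set.Iio (0 : ℝ) ×ˢ Set.univ) →
      (∀ s t : ℝ, s < t → t < 0 → ∀ x, v t x =
        Literature.Analysis.UnboundedOperators.heatExtension (v s) (t - s) x -
          Literature.Analysis.FluidPDE.oseenDuhamel 1 s v v t x) →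
      (∀ t < 0, Literature.Analysis.FluidPDE.VectorCalculus.IsDivFree (v t)) →
      (∀ s < 0, ∀ y, ⟪Literature.Analysis.FluidPDE.curl (v s) y, EuclideanSpace.single 2 1⟫_ℝ = 0) →
      ∀ W : Set (ℝ × EuclideanSpace ℝ (Fin 3)), IsOpen W → W.Nonempty → W ⊆ Set.Iio (0 : ℝ) ×ˢ Set.univ →
        (∀ z ∈ W, Literature.Analysis.FluidPDE.curl (v z.1) z.2 ≠ 0 ∧
          (fderiv ℝ (v z.1) z.2 (EuclideanSpace.single 0 1) 2 ≠ 0 ∨ fderiv ℝ (v z.1) z.2 (EuclideanSpace.single 1 1) 2 ≠ 0) ∧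
          (fderiv ℝ (v z.1) z.2 (EuclideanSpace.single 2 1) 0 ≠ 0 ∨ fderiv ℝ (v z.1) z.2 (EuclideanSpace.single 2 1) 1 ≠ 0)) →
        (∀ m : ℝ → ℝ, ∀ W₁ : Set (ℝ × EuclideanSpace ℝ (Fin 3)), W₁ ⊆ W → IsOpen W₁ → W₁.Nonempty →
          ∃ z ∈ W₁, ∃ b : Fin 3, b ≠ 2 ∧
            fderiv ℝ (v z.1) z.2 (EuclideanSpace.single 2 1) b ≠
              m z.1 * fderiv ℝ (v z.1) z.2 (EuclideanSpace.single b 1) 2) →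
        (∀ z ∈ W,
          fderiv ℝ (fun x => fderiv ℝ (v z.1) x (EuclideanSpace.single 2 1) 2) z.2 (EuclideanSpace.single 0 1) *
              fderiv ℝ (v z.1) z.2 (EuclideanSpace.single 1 1) 2 -
            fderiv ℝ (fun x => fderiv ℝ (v z.1) x (EuclideanSpace.single 2 1) 2) z.2 (EuclideanSpace.single 1 1) *
              fderiv ℝ (v z.1) z.2 (EuclideanSpace.single 0 1) 2 ≠ 0) →
        ∀ a b : ℝ, W ⊆ Set.Ioo a b ×ˢ Set.univ →
          (∀ s ∈ Set.Ioo a b, ∀ y : EuclideanSpace ℝ (Fin 3),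
            0 ≤ fderiv ℝ (v s) y (EuclideanSpace.single 2 1) 0 * fderiv ℝ (v s) y (EuclideanSpace.single 0 1) 2 +
              fderiv ℝ (v s) y (EuclideanSpace.single 2 1) 1 * fderiv ℝ (v s) y (EuclideanSpace.single 1 1) 2) →
        (∀ m : ℝ → ℝ → ℝ, ∀ W₁ : Set (ℝ × EuclideanSpace ℝ (Fin 3)), W₁ ⊆ W → IsOpen W₁ → W₁.Nonempty →
          ∃ z ∈ W₁, ∃ b : Fin 3, b ≠ 2 ∧
            fderiv ℝ (v z.1) z.2 (EuclideanSpace.single 2 1) b ≠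
              m z.1 (z.2 2) * fderiv ℝ (v z.1) z.2 (EuclideanSpace.single b 1) 2) →
        ¬ Literature.Analysis.FluidPDE.IsBackwardSingularPoint v 0 := by
  intro C v hrate hcont hmild hdiv hpol W hW hWne hWs hnd hpin htw a b hab hslab hthick
  exact stub_congruenceDoor C v hrate hcont hmild
    (stub_congruentSemiEllipticThick C v hrate hcont hmild hdiv hpol W hW hWne hWs hnd hpin htw a b hab hslab hthick)

/-! ### Composition, layer 2 (proved): `lrc_jet` v5's `stub_twisting` by Theorem A's census form `twisting_regular_of_three` -/

/-- `lrc_jet` v5 `stub_twisting`, VERBATIM, from the three layer-1 theorems via the tree theorem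
`…ThmAThreeStubs.twisting_regular_of_three` (K2-p2 g6, p581287: type dichotomy + Theorem A relocation). -/
theorem twisting_of_door :
    ∀ (C : ℝ) (v : ℝ → EuclideanSpace ℝ (Fin 3) → EuclideanSpace ℝ (Fin 3)),
      Literature.Analysis.FluidPDE.HasTypeITimeDecay C v →
      ContinuousOn (Function.uncurry v) (Set.Iio (0 : ℝ) ×ˢ Set.univ) →
      (∀ s t : ℝ, s < t → t < 0 → ∀ x, v t x =
        Literature.Analysis.UnboundedOperators.heatExtension (v s) (t - s) x -
          Literature.Analysis.FluidPDE.oseenDuhamel 1 s v v t x) →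
      (∀ t < 0, Literature.Analysis.FluidPDE.VectorCalculus.IsDivFree (v t)) →
      (∀ s < 0, ∀ y, ⟪Literature.Analysis.FluidPDE.curl (v s) y, EuclideanSpace.single 2 1⟫_ℝ = 0) →
      ∀ W : Set (ℝ × EuclideanSpace ℝ (Fin 3)), IsOpen W → W.Nonempty → W ⊆ Set.Iio (0 : ℝ) ×ˢ Set.univ →
        (∀ z ∈ W, Literature.Analysis.FluidPDE.curl (v z.1) z.2 ≠ 0 ∧
          (fderiv ℝ (v z.1) z.2 (EuclideanSpace.single 0 1) 2 ≠ 0 ∨ fderiv ℝ (v z.1) z.2 (EuclideanSpace.single 1 1) 2 ≠ 0) ∧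
          (fderiv ℝ (v z.1) z.2 (EuclideanSpace.single 2 1) 0 ≠ 0 ∨ fderiv ℝ (v z.1) z.2 (EuclideanSpace.single 2 1) 1 ≠ 0)) →
        (∀ m : ℝ → ℝ, ∀ W₁ : Set (ℝ × EuclideanSpace ℝ (Fin 3)), W₁ ⊆ W → IsOpen W₁ → W₁.Nonempty →
          ∃ z ∈ W₁, ∃ b : Fin 3, b ≠ 2 ∧
            fderiv ℝ (v z.1) z.2 (EuclideanSpace.single 2 1) b ≠
              m z.1 * fderiv ℝ (v z.1) z.2 (EuclideanSpace.single b 1) 2) →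
        (∀ z ∈ W,
          fderiv ℝ (fun x => fderiv ℝ (v z.1) x (EuclideanSpace.single 2 1) 2) z.2 (EuclideanSpace.single 0 1) *
              fderiv ℝ (v z.1) z.2 (EuclideanSpace.single 1 1) 2 -
            fderiv ℝ (fun x => fderiv ℝ (v z.1) x (EuclideanSpace.single 2 1) 2) z.2 (EuclideanSpace.single 1 1) *
              fderiv ℝ (v z.1) z.2 (EuclideanSpace.single 0 1) 2 ≠ 0) →
        ¬ Literature.Analysis.FluidPDE.IsBackwardSingularPoint v 0 := by
  intro C v hrate hcont hmild hdiv hpol W hW hWne hWs hnd hpin htw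
  exact twisting_regular_of_three C v hrate hcont hmild hdiv
    (hyperbolicTH_of_door C v hrate hcont hmild hdiv hpol)
    (hyperbolicThick_of_door C v hrate hcont hmild hdiv hpol)
    (semiEllipticThick_of_door C v hrate hcont hmild hdiv hpol)
    W hW hWne hWs hnd hpin htw

/-- `lrc_jet` v5 `stub_untwisted` — the TREE THEOREM `…StubUntwisted.stub_untwisted` (K2-p1 g6, p561151). -/
theorem untwisted_tree :
    ∀ (C : ℝ) (v : ℝ → EuclideanSpace ℝ (Fin 3) → EuclideanSpace ℝ (Fin 3)),
      Literature.Analysis.FluidPDE.HasTypeITimeDecay C v →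
      ContinuousOn (Function.uncurry v) (Set.Iio (0 : ℝ) ×ˢ Set.univ) →
      (∀ s t : ℝ, s < t → t < 0 → ∀ x, v t x =
        Literature.Analysis.UnboundedOperators.heatExtension (v s) (t - s) x -
          Literature.Analysis.FluidPDE.oseenDuhamel 1 s v v t x) →
      (∀ t < 0, Literature.Analysis.FluidPDE.VectorCalculus.IsDivFree (v t)) →
      (∀ s < 0, ∀ y, ⟪Literature.Analysis.FluidPDE.curl (v s) y, EuclideanSpace.single 2 1⟫_ℝ = 0) →
      ∀ W : Set (ℝ × EuclideanSpace ℝ (Fin 3)), IsOpen W → W.Nonempty → W ⊆ Set.Iio (0 : ℝ) ×ˢ Set.univ →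
        (∀ z ∈ W, Literature.Analysis.FluidPDE.curl (v z.1) z.2 ≠ 0 ∧
          (fderiv ℝ (v z.1) z.2 (EuclideanSpace.single 0 1) 2 ≠ 0 ∨ fderiv ℝ (v z.1) z.2 (EuclideanSpace.single 1 1) 2 ≠ 0) ∧
          (fderiv ℝ (v z.1) z.2 (EuclideanSpace.single 2 1) 0 ≠ 0 ∨ fderiv ℝ (v z.1) z.2 (EuclideanSpace.single 2 1) 1 ≠ 0)) →
        (∀ z ∈ W,
          fderiv ℝ (fun x => fderiv ℝ (v z.1) x (EuclideanSpace.single 2 1) 2) z.2 (EuclideanSpace.single 0 1) *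
              fderiv ℝ (v z.1) z.2 (EuclideanSpace.single 1 1) 2 -
            fderiv ℝ (fun x => fderiv ℝ (v z.1) x (EuclideanSpace.single 2 1) 2) z.2 (EuclideanSpace.single 1 1) *
              fderiv ℝ (v z.1) z.2 (EuclideanSpace.single 0 1) 2 = 0) →
        ¬ Literature.Analysis.FluidPDE.IsBackwardSingularPoint v 0 :=
  Summit.NavierStokesRegularity.NavierStokesRegularity.Theorems.PoloidalWindowDoorPoloidalWindowRigidityStubUntwisted.stub_untwisted


/-- **NON-DEGENERATE + v3 PIN ⇒ regular (proved from the two stubs by the pointwise twist dichotomy).**  The twist bracket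
`T(s,y) = ∂₀(∂₂v₂)·∂₁v₂ − ∂₁(∂₂v₂)·∂₀v₂` is jointly continuous on the backward slab (the Jacobian entries of a class
profile and their spatial derivatives are jointly real-analytic there: `…K2OfLrcSlope.analyticOnNhd_uncurry_fderiv_entry`,
`…AnalyticPropagation.analyticOnNhd_uncurry_fderiv_slice_apply`).  Hence either `T ≡ 0` on `W` (`stub_untwisted`), or
`T ≠ 0` on the nonempty open subset `W ∩ {T ≠ 0}`, which inherits non-degeneracy and the pin (`stub_twisting`). -/
theorem ndRegular :
    ∀ (C : ℝ) (v : ℝ → EuclideanSpace ℝ (Fin 3) → EuclideanSpace ℝ (Fin 3)),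
      Literature.Analysis.FluidPDE.HasTypeITimeDecay C v →
      ContinuousOn (Function.uncurry v) (Set.Iio (0 : ℝ) ×ˢ Set.univ) →
      (∀ s t : ℝ, s < t → t < 0 → ∀ x, v t x =
        Literature.Analysis.UnboundedOperators.heatExtension (v s) (t - s) x -
          Literature.Analysis.FluidPDE.oseenDuhamel 1 s v v t x) →
      (∀ t < 0, Literature.Analysis.FluidPDE.VectorCalculus.IsDivFree (v t)) →
      (∀ s < 0, ∀ y, ⟪Literature.Analysis.FluidPDE.curl (v s) y, EuclideanSpace.single 2 1⟫_ℝ = 0) →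
      ∀ W : Set (ℝ × EuclideanSpace ℝ (Fin 3)), IsOpen W → W.Nonempty → W ⊆ Set.Iio (0 : ℝ) ×ˢ Set.univ →
        (∀ z ∈ W, Literature.Analysis.FluidPDE.curl (v z.1) z.2 ≠ 0 ∧
          (fderiv ℝ (v z.1) z.2 (EuclideanSpace.single 0 1) 2 ≠ 0 ∨ fderiv ℝ (v z.1) z.2 (EuclideanSpace.single 1 1) 2 ≠ 0) ∧
          (fderiv ℝ (v z.1) z.2 (EuclideanSpace.single 2 1) 0 ≠ 0 ∨ fderiv ℝ (v z.1) z.2 (EuclideanSpace.single 2 1) 1 ≠ 0)) →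
        (∀ m : ℝ → ℝ, ∀ W₁ : Set (ℝ × EuclideanSpace ℝ (Fin 3)), W₁ ⊆ W → IsOpen W₁ → W₁.Nonempty →
          ∃ z ∈ W₁, ∃ b : Fin 3, b ≠ 2 ∧
            fderiv ℝ (v z.1) z.2 (EuclideanSpace.single 2 1) b ≠
              m z.1 * fderiv ℝ (v z.1) z.2 (EuclideanSpace.single b 1) 2) →
        ¬ Literature.Analysis.FluidPDE.IsBackwardSingularPoint v 0 := by
  intro C v hrate hcont hmild hdiv hpol W hW hWne hWs hnd hpin
  -- the twist bracket as a function on space–time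
  set T : ℝ × EuclideanSpace ℝ (Fin 3) → ℝ := fun z =>
    fderiv ℝ (fun x => fderiv ℝ (v z.1) x (EuclideanSpace.single 2 1) 2) z.2 (EuclideanSpace.single 0 1) *
              fderiv ℝ (v z.1) z.2 (EuclideanSpace.single 1 1) 2 -
            fderiv ℝ (fun x => fderiv ℝ (v z.1) x (EuclideanSpace.single 2 1) 2) z.2 (EuclideanSpace.single 1 1) *
              fderiv ℝ (v z.1) z.2 (EuclideanSpace.single 0 1) 2 with hT
  by_cases htw : ∃ z ∈ W, T z ≠ 0
  · -- TWISTING somewhere: restrict to the open set where `T ≠ 0`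
    obtain ⟨z₀, hz₀W, hz₀⟩ := htw
    have hslab : IsOpen (Set.Iio (0 : ℝ) ×ˢ (Set.univ : Set (EuclideanSpace ℝ (Fin 3)))) :=
      isOpen_Iio.prod isOpen_univ
    have hD : ∀ j i : Fin 3, ContinuousOn
        (fun z : ℝ × EuclideanSpace ℝ (Fin 3) => fderiv ℝ (v z.1) z.2 (EuclideanSpace.single j 1) i)
        (Set.Iio (0 : ℝ) ×ˢ Set.univ) := fun j i => continuousOn_fderiv_entry hrate hcont hmild j i
    have hD2 : ∀ b : Fin 3, ContinuousOn
        (fun z : ℝ × EuclideanSpace ℝ (Fin 3) =>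
          fderiv ℝ (fun x => fderiv ℝ (v z.1) x (EuclideanSpace.single 2 1) 2) z.2 (EuclideanSpace.single b 1))
        (Set.Iio (0 : ℝ) ×ˢ Set.univ) := by
      intro b
      have h22 := analyticOnNhd_uncurry_fderiv_entry hrate hcont hmild 2 2
      have h := analyticOnNhd_uncurry_fderiv_slice_apply (w := fun s y => fderiv ℝ (v s) y (EuclideanSpace.single 2 1) 2)
        h22 isOpen_Iio (v := fun _ _ => EuclideanSpace.single b 1) analyticOnNhd_const
      exact h.continuousOn
    have hTc : ContinuousOn T (Set.Iio (0 : ℝ) ×ˢ Set.univ) := by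
      rw [hT]
      exact ((hD2 0).mul (hD 1 2)).sub ((hD2 1).mul (hD 0 2))
    have hO : IsOpen ((Set.Iio (0 : ℝ) ×ˢ Set.univ) ∩ T ⁻¹' {0}ᶜ) :=
      hTc.isOpen_inter_preimage hslab isOpen_compl_singleton
    set W₃ : Set (ℝ × EuclideanSpace ℝ (Fin 3)) := W ∩ ((Set.Iio (0 : ℝ) ×ˢ Set.univ) ∩ T ⁻¹' {0}ᶜ) with hW₃
    have hW₃o : IsOpen W₃ := hW.inter hO
    have hW₃W : W₃ ⊆ W := Set.inter_subset_left
    have hW₃ne : W₃.Nonempty := ⟨z₀, hz₀W, hWs hz₀W, hz₀⟩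
    refine twisting_of_door C v hrate hcont hmild hdiv hpol W₃ hW₃o hW₃ne (hW₃W.trans hWs)
      (fun z hz => hnd z (hW₃W hz)) (fun m W₁ hW₁ hW₁o hW₁ne => hpin m W₁ (hW₁.trans hW₃W) hW₁o hW₁ne) ?_
    intro z hz
    exact hz.2.2
  · -- UNTWISTED on all of `W`
    push Not at htw
    exact untwisted_tree C v hrate hcont hmild hdiv hpol W hW hWne hWs hnd htw

/-- **LRC″ with spatial pins, UNDER THE SINGULARITY ASSUMPTION, from the two stubs** (proved): the hypothesis `hLRC`
of `…K2OfLrcSpatial.nonflatLiouville_of_lrc_spatial` for a profile that IS backward-singular at the apex — vacuously, since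
`ndRegular` (the twist dichotomy over the two stubs) says such a profile has no non-degenerate open set with the pin. -/
theorem lrcSpatial_of_stubs :
    ∀ (C : ℝ) (v : ℝ → EuclideanSpace ℝ (Fin 3) → EuclideanSpace ℝ (Fin 3)),
      Literature.Analysis.FluidPDE.HasTypeITimeDecay C v →
      ContinuousOn (Function.uncurry v) (Set.Iio (0 : ℝ) ×ˢ Set.univ) →
      (∀ s t : ℝ, s < t → t < 0 → ∀ x, v t x =
        Literature.Analysis.UnboundedOperators.heatExtension (v s) (t - s) x -
          Literature.Analysis.FluidPDE.oseenDuhamel 1 s v v t x) →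
      (∀ t < 0, Literature.Analysis.FluidPDE.VectorCalculus.IsDivFree (v t)) →
      (∀ s < 0, ∀ y, ⟪Literature.Analysis.FluidPDE.curl (v s) y, EuclideanSpace.single 2 1⟫_ℝ = 0) →
      Literature.Analysis.FluidPDE.IsBackwardSingularPoint v 0 →
      ∀ W : Set (ℝ × EuclideanSpace ℝ (Fin 3)), IsOpen W → W.Nonempty → W ⊆ Set.Iio (0 : ℝ) ×ˢ Set.univ →
        (∀ z ∈ W, Literature.Analysis.FluidPDE.curl (v z.1) z.2 ≠ 0 ∧
          (fderiv ℝ (v z.1) z.2 (EuclideanSpace.single 0 1) 2 ≠ 0 ∨ fderiv ℝ (v z.1) z.2 (EuclideanSpace.single 1 1) 2 ≠ 0) ∧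
          (fderiv ℝ (v z.1) z.2 (EuclideanSpace.single 2 1) 0 ≠ 0 ∨ fderiv ℝ (v z.1) z.2 (EuclideanSpace.single 2 1) 1 ≠ 0)) →
        (∀ m : ℝ → ℝ, ∀ W₁ : Set (ℝ × EuclideanSpace ℝ (Fin 3)), W₁ ⊆ W → IsOpen W₁ → W₁.Nonempty →
          ∃ z ∈ W₁, ∃ b : Fin 3, b ≠ 2 ∧
            fderiv ℝ (v z.1) z.2 (EuclideanSpace.single 2 1) b ≠
              m z.1 * fderiv ℝ (v z.1) z.2 (EuclideanSpace.single b 1) 2) →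
        ∃ s : ℝ, s < 0 ∧ ∃ U : Set (EuclideanSpace ℝ (Fin 3)), IsOpen U ∧ U.Nonempty ∧
          ((∃ e : EuclideanSpace ℝ (Fin 3), e ≠ 0 ∧ ∀ y ∈ U, fderiv ℝ (Literature.Analysis.FluidPDE.curl (v s)) y e = 0) ∨
           (∃ c : EuclideanSpace ℝ (Fin 3), ∀ y ∈ U,
              Literature.Analysis.FluidPDE.rotGen (Literature.Analysis.FluidPDE.curl (v s) y) =
                fderiv ℝ (Literature.Analysis.FluidPDE.curl (v s)) y (Literature.Analysis.FluidPDE.rotGen (y - c)))) := by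
  intro C v hrate hcont hmild hdiv hpol hsing W hW hWne hWs hnd hpin
  exact absurd hsing (ndRegular C v hrate hcont hmild hdiv hpol W hW hWne hWs hnd hpin)

/-- **(former STUB L2, now a TREE THEOREM) = (TV), BOUNDED-ALONG-A-SEQUENCE HALF** — the registered stub
`stub_tvLiminf` of v2, PROVED by ns-poloidal-K2-p2 g3 (p525351 `…TimeShearLiminf.stub_tvLiminf`, M12 variance run on
`ψ = (1−μ)v₂` with the Grönwall started along the bounded sequence; bricks ns-poloidal-K2-p3 g4 p519098/p521329, K2-p2
p524146/p524699).  For a profile of the route's Type-I class, poloidal along `e₃`: if every slice `s < 0` is proportional-shear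
with a negative real-analytic non-constant slope function bounded below along SOME sequence of times tending to `−∞`, then
`v` is not backward-singular at the apex. -/
theorem tvLiminf_tree :
    ∀ (C : ℝ) (v : ℝ → EuclideanSpace ℝ (Fin 3) → EuclideanSpace ℝ (Fin 3)),
      Literature.Analysis.FluidPDE.HasTypeITimeDecay C v →
      ContinuousOn (Function.uncurry v) (Set.Iio (0 : ℝ) ×ˢ Set.univ) →
      (∀ s t : ℝ, s < t → t < 0 → ∀ x, v t x =
        Literature.Analysis.UnboundedOperators.heatExtension (v s) (t - s) x -
          Literature.Analysis.FluidPDE.oseenDuhamel 1 s v v t x) →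
      (∀ t < 0, Literature.Analysis.FluidPDE.VectorCalculus.IsDivFree (v t)) →
      (∀ s < 0, ∀ y, ⟪Literature.Analysis.FluidPDE.curl (v s) y, EuclideanSpace.single 2 1⟫_ℝ = 0) →
      ∀ μ : ℝ → ℝ, (∀ s < 0, μ s < 0) → (∀ s < 0, AnalyticAt ℝ μ s) →
        (∃ s₁ s₂ : ℝ, s₁ < 0 ∧ s₂ < 0 ∧ μ s₁ ≠ μ s₂) →
        (∀ s < 0, ∀ y, ∀ b : Fin 3, b ≠ 2 →
          fderiv ℝ (v s) y (EuclideanSpace.single 2 1) b = μ s * fderiv ℝ (v s) y (EuclideanSpace.single b 1) 2) →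
        (∃ M : ℝ, ∀ T : ℝ, ∃ τ < T, -M ≤ μ τ) →
        ¬ Literature.Analysis.FluidPDE.IsBackwardSingularPoint v 0 :=
  Summit.NavierStokesRegularity.NavierStokesRegularity.Theorems.PoloidalWindowDoorPoloidalWindowRigidityTimeShearLiminf.stub_tvLiminf

/-- **(TV) from the two halves (proved).**  The hypothesis `hTV` of `…K2OfLrcSpatial.nonflatLiouville_of_lrc_spatial`,
quantified over the class: the bounded-along-a-sequence half is `stub_tvLiminf`; otherwise `μ(τ) → −∞`, i.e.
`∀ M ∃ T ∀ τ < T, M ≤ |μ τ|`, and the lead's tree theorem `…HorizontalFlatPast.nonflatLiouville_of_timeShear_unbounded`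
(growth branch, zoom-out) ends. -/
theorem tv_of_stubs :
    ∀ (C : ℝ) (v : ℝ → EuclideanSpace ℝ (Fin 3) → EuclideanSpace ℝ (Fin 3)),
      Literature.Analysis.FluidPDE.HasTypeITimeDecay C v →
      ContinuousOn (Function.uncurry v) (Set.Iio (0 : ℝ) ×ˢ Set.univ) →
      (∀ s t : ℝ, s < t → t < 0 → ∀ x, v t x =
        Literature.Analysis.UnboundedOperators.heatExtension (v s) (t - s) x -
          Literature.Analysis.FluidPDE.oseenDuhamel 1 s v v t x) →
      (∀ t < 0, Literature.Analysis.FluidPDE.VectorCalculus.IsDivFree (v t)) →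
      (∀ s < 0, ∀ y, ⟪Literature.Analysis.FluidPDE.curl (v s) y, EuclideanSpace.single 2 1⟫_ℝ = 0) →
      ∀ μ : ℝ → ℝ, (∀ s < 0, μ s < 0) → (∀ s < 0, AnalyticAt ℝ μ s) →
        (∃ s₁ s₂ : ℝ, s₁ < 0 ∧ s₂ < 0 ∧ μ s₁ ≠ μ s₂) →
        (∀ s < 0, ∀ y, ∀ b : Fin 3, b ≠ 2 →
          fderiv ℝ (v s) y (EuclideanSpace.single 2 1) b = μ s * fderiv ℝ (v s) y (EuclideanSpace.single b 1) 2) →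
        ¬ Literature.Analysis.FluidPDE.IsBackwardSingularPoint v 0 := by
  intro C v hrate hcont hmild hdiv hpol μ hneg han hnc hslope
  by_cases hB : ∃ M : ℝ, ∀ T : ℝ, ∃ τ < T, -M ≤ μ τ
  · exact tvLiminf_tree C v hrate hcont hmild hdiv hpol μ hneg han hnc hslope hB
  · push Not at hB
    refine nonflatLiouville_of_timeShear_unbounded hrate hcont hmild hdiv hpol hslope fun M => ?_
    obtain ⟨T, hT⟩ := hB M
    refine ⟨T, fun τ hτ => ?_⟩
    have h1 : μ τ < -M := hT τ hτ
    have h2 : M < -μ τ := by linarith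
    exact h2.le.trans (neg_le_abs (μ τ))

/-- **The slice-sharp residue of the `slicesharp` line from the two stubs** (its symmetry/genericity hypotheses are not
needed): class + poloidal ⇒ not backward-singular — by contradiction, K2-p3 g4's `nonflatLiouville_of_lrc_spatial` with
`lrcSpatial_of_stubs` (which uses the assumed singularity) and `tv_of_stubs`. -/
theorem sliceSharpNonflatLiouville_of_congruenceDoor :
    ∀ (C : ℝ) (v : ℝ → EuclideanSpace ℝ (Fin 3) → EuclideanSpace ℝ (Fin 3)),
      Literature.Analysis.FluidPDE.HasTypeITimeDecay C v →
      ContinuousOn (Function.uncurry v) (Set.Iio (0 : ℝ) ×ˢ Set.univ) →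
      (∀ s t : ℝ, s < t → t < 0 → ∀ x, v t x =
        Literature.Analysis.UnboundedOperators.heatExtension (v s) (t - s) x -
          Literature.Analysis.FluidPDE.oseenDuhamel 1 s v v t x) →
      (∀ t < 0, Literature.Analysis.FluidPDE.VectorCalculus.IsDivFree (v t)) →
      (∀ s < 0, ∀ y, ⟪Literature.Analysis.FluidPDE.curl (v s) y, EuclideanSpace.single 2 1⟫_ℝ = 0) →
      (∀ s < 0, ∀ y, ⟪fderiv ℝ (v s) y (Literature.Analysis.FluidPDE.curl (v s) y), EuclideanSpace.single 2 1⟫_ℝ = 0) →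
      (∀ s < 0, ∀ b : EuclideanSpace ℝ (Fin 3), b ≠ 0 → ∃ y,
        Literature.Analysis.FluidPDE.cross (Literature.Analysis.FluidPDE.curl (v s) y) b ≠ 0) →
      (∀ s < 0, ∃ y, fderiv ℝ (v s) y (EuclideanSpace.single 2 1) 0 ≠ 0 ∨
        fderiv ℝ (v s) y (EuclideanSpace.single 2 1) 1 ≠ 0) →
      (∀ s < 0, ∀ a : EuclideanSpace ℝ (Fin 3), a ≠ 0 → ⟪a, EuclideanSpace.single 2 1⟫_ℝ = 0 →
        ∃ y, ⟪fderiv ℝ (v s) y a, EuclideanSpace.single 2 1⟫_ℝ ≠ 0) →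
      (∀ s < 0, ∀ e : EuclideanSpace ℝ (Fin 3), e ≠ 0 → ∃ (y : EuclideanSpace ℝ (Fin 3)) (l : ℝ), v s (y + l • e) ≠ v s y) →
      (∀ s < 0, ∀ (L : EuclideanSpace ℝ (Fin 3) ≃ₗᵢ[ℝ] EuclideanSpace ℝ (Fin 3)) (c : EuclideanSpace ℝ (Fin 3)),
        ¬ Literature.Analysis.FluidPDE.IsAxisymmetric (fun y => L.symm (v s (L y + c)))) →
      (∃ lam : ℝ, 0 < lam ∧ ∃ s < 0, ∃ y, lam • v (lam ^ 2 * s) (lam • y) ≠ v s y) →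
      ¬ Literature.Analysis.FluidPDE.IsBackwardSingularPoint v 0 := by
  intro C v hrate hcont hmild hdiv hpol _ _ _ _ _ _ _ hsing
  exact nonflatLiouville_of_lrc_spatial hrate hcont hmild hdiv hpol
    (lrcSpatial_of_stubs C v hrate hcont hmild hdiv hpol hsing) (tv_of_stubs C v hrate hcont hmild hdiv hpol) hsing

/-- **COMPOSITION (proved): the crux `PoloidalWindowRigidity` from the four stubs G0–G3**, via `twisting_of_door` (layer 2),
the tree theorem `untwisted_tree` (= `…StubUntwisted.stub_untwisted`) and the landed reduction `…Sharper.poloidalWindowRigidity_of_sliceSharpNonflatLiouville`. -/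
theorem PoloidalWindowRigidity_of_congruenceDoor :
    Summit.NavierStokesRegularity.NavierStokesRegularity.Theses.PoloidalWindowDoor.PoloidalWindowRigidity :=
  poloidalWindowRigidity_of_sliceSharpNonflatLiouville sliceSharpNonflatLiouville_of_congruenceDoor

/-! ### The emptiness currency still closes G2 and G3 BY NAME (proved; G1 ⇐ `hemptyHyp` is p581830's extraction with its
unused singularity binder dropped — a localisation file for the lead, not restated here) -/

open scoped Laplacian

/-- **`hempty_thick ⇒ G2`** (proved, four lines, same as `mixed_type` v2's closer): K2-p4's
`…ThickStubsOfLocalEmpty.exists_timeHeight_subwindow_of_localEmptyThick` yields a time–height sub-window, contradicting the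
thickness clause — so a thick emptiness certificate closes the WEAKER stub too (its hypotheses are inconsistent). -/
theorem congruentHyperbolicThick_of_localEmptyThick (hempty_thick : ∀ (u : ℝ → EuclideanSpace ℝ (Fin 3) → EuclideanSpace ℝ (Fin 3))
      (U : Set (ℝ × EuclideanSpace ℝ (Fin 3))) (p₀ : ℝ × EuclideanSpace ℝ (Fin 3)),
      IsOpen U → p₀ ∈ U →
      AnalyticOnNhd ℝ (Function.uncurry u) U →
      (∀ p ∈ U, fderiv ℝ (u p.1) p.2 (EuclideanSpace.single 0 1) 0 + fderiv ℝ (u p.1) p.2 (EuclideanSpace.single 1 1) 1 +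
        fderiv ℝ (u p.1) p.2 (EuclideanSpace.single 2 1) 2 = 0) →
      (∀ p ∈ U, fderiv ℝ (u p.1) p.2 (EuclideanSpace.single 0 1) 1 = fderiv ℝ (u p.1) p.2 (EuclideanSpace.single 1 1) 0) →
      (∀ p ∈ U, fderiv ℝ (u p.1) p.2 (EuclideanSpace.single 2 1) 0 * fderiv ℝ (u p.1) p.2 (EuclideanSpace.single 1 1) 2 -
        fderiv ℝ (u p.1) p.2 (EuclideanSpace.single 2 1) 1 * fderiv ℝ (u p.1) p.2 (EuclideanSpace.single 0 1) 2 = 0) →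
      (∀ p ∈ U, ∀ j k : Fin 3,
        fderiv ℝ (fun y => deriv (fun s => u s y k) p.1 + fderiv ℝ (fun y' => u p.1 y' k) y (u p.1 y) -
            (Δ (fun y' => u p.1 y' k)) y) p.2 (EuclideanSpace.single j 1) =
          fderiv ℝ (fun y => deriv (fun s => u s y j) p.1 + fderiv ℝ (fun y' => u p.1 y' j) y (u p.1 y) -
            (Δ (fun y' => u p.1 y' j)) y) p.2 (EuclideanSpace.single k 1)) →
      fderiv ℝ (fun y => fderiv ℝ (u p₀.1) y (EuclideanSpace.single 2 1) 2) p₀.2 (EuclideanSpace.single 0 1) *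
            fderiv ℝ (u p₀.1) p₀.2 (EuclideanSpace.single 1 1) 2 -
          fderiv ℝ (fun y => fderiv ℝ (u p₀.1) y (EuclideanSpace.single 2 1) 2) p₀.2 (EuclideanSpace.single 1 1) *
            fderiv ℝ (u p₀.1) p₀.2 (EuclideanSpace.single 0 1) 2 ≠ 0 →
      (fderiv ℝ (u p₀.1) p₀.2 (EuclideanSpace.single 0 1) 2 ≠ 0 ∨ fderiv ℝ (u p₀.1) p₀.2 (EuclideanSpace.single 1 1) 2 ≠ 0) →
      (fderiv ℝ (u p₀.1) p₀.2 (EuclideanSpace.single 2 1) 0 ≠ 0 ∨ fderiv ℝ (u p₀.1) p₀.2 (EuclideanSpace.single 2 1) 1 ≠ 0) →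
      Literature.Analysis.FluidPDE.curl (u p₀.1) p₀.2 ≠ 0 →
      (fderiv ℝ (fun y =>
            (fderiv ℝ (u p₀.1) y (EuclideanSpace.single 2 1) 0 * fderiv ℝ (u p₀.1) y (EuclideanSpace.single 0 1) 2 +
                fderiv ℝ (u p₀.1) y (EuclideanSpace.single 2 1) 1 * fderiv ℝ (u p₀.1) y (EuclideanSpace.single 1 1) 2) /
              (fderiv ℝ (u p₀.1) y (EuclideanSpace.single 0 1) 2 ^ 2 + fderiv ℝ (u p₀.1) y (EuclideanSpace.single 1 1) 2 ^ 2))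
            p₀.2 (EuclideanSpace.single 0 1) ≠ 0 ∨
        fderiv ℝ (fun y =>
            (fderiv ℝ (u p₀.1) y (EuclideanSpace.single 2 1) 0 * fderiv ℝ (u p₀.1) y (EuclideanSpace.single 0 1) 2 +
                fderiv ℝ (u p₀.1) y (EuclideanSpace.single 2 1) 1 * fderiv ℝ (u p₀.1) y (EuclideanSpace.single 1 1) 2) /
              (fderiv ℝ (u p₀.1) y (EuclideanSpace.single 0 1) 2 ^ 2 + fderiv ℝ (u p₀.1) y (EuclideanSpace.single 1 1) 2 ^ 2))
            p₀.2 (EuclideanSpace.single 1 1) ≠ 0) →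
      False) :
    ∀ (C : ℝ) (v : ℝ → EuclideanSpace ℝ (Fin 3) → EuclideanSpace ℝ (Fin 3)),
      Literature.Analysis.FluidPDE.HasTypeITimeDecay C v →
      ContinuousOn (Function.uncurry v) (Set.Iio (0 : ℝ) ×ˢ Set.univ) →
      (∀ s t : ℝ, s < t → t < 0 → ∀ x, v t x =
        Literature.Analysis.UnboundedOperators.heatExtension (v s) (t - s) x -
          Literature.Analysis.FluidPDE.oseenDuhamel 1 s v v t x) →
      (∀ t < 0, Literature.Analysis.FluidPDE.VectorCalculus.IsDivFree (v t)) →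
      (∀ s < 0, ∀ y, ⟪Literature.Analysis.FluidPDE.curl (v s) y, EuclideanSpace.single 2 1⟫_ℝ = 0) →
      ∀ W : Set (ℝ × EuclideanSpace ℝ (Fin 3)), IsOpen W → W.Nonempty → W ⊆ Set.Iio (0 : ℝ) ×ˢ Set.univ →
        (∀ z ∈ W, Literature.Analysis.FluidPDE.curl (v z.1) z.2 ≠ 0 ∧
          (fderiv ℝ (v z.1) z.2 (EuclideanSpace.single 0 1) 2 ≠ 0 ∨ fderiv ℝ (v z.1) z.2 (EuclideanSpace.single 1 1) 2 ≠ 0) ∧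
          (fderiv ℝ (v z.1) z.2 (EuclideanSpace.single 2 1) 0 ≠ 0 ∨ fderiv ℝ (v z.1) z.2 (EuclideanSpace.single 2 1) 1 ≠ 0)) →
        (∀ m : ℝ → ℝ, ∀ W₁ : Set (ℝ × EuclideanSpace ℝ (Fin 3)), W₁ ⊆ W → IsOpen W₁ → W₁.Nonempty →
          ∃ z ∈ W₁, ∃ b : Fin 3, b ≠ 2 ∧
            fderiv ℝ (v z.1) z.2 (EuclideanSpace.single 2 1) b ≠
              m z.1 * fderiv ℝ (v z.1) z.2 (EuclideanSpace.single b 1) 2) →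
        (∀ z ∈ W,
          fderiv ℝ (fun x => fderiv ℝ (v z.1) x (EuclideanSpace.single 2 1) 2) z.2 (EuclideanSpace.single 0 1) *
              fderiv ℝ (v z.1) z.2 (EuclideanSpace.single 1 1) 2 -
            fderiv ℝ (fun x => fderiv ℝ (v z.1) x (EuclideanSpace.single 2 1) 2) z.2 (EuclideanSpace.single 1 1) *
              fderiv ℝ (v z.1) z.2 (EuclideanSpace.single 0 1) 2 ≠ 0) →
        (∀ z ∈ W,
          fderiv ℝ (v z.1) z.2 (EuclideanSpace.single 2 1) 0 * fderiv ℝ (v z.1) z.2 (EuclideanSpace.single 0 1) 2 +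
            fderiv ℝ (v z.1) z.2 (EuclideanSpace.single 2 1) 1 * fderiv ℝ (v z.1) z.2 (EuclideanSpace.single 1 1) 2 < 0) →
        (∀ m : ℝ → ℝ → ℝ, ∀ W₁ : Set (ℝ × EuclideanSpace ℝ (Fin 3)), W₁ ⊆ W → IsOpen W₁ → W₁.Nonempty →
          ∃ z ∈ W₁, ∃ b : Fin 3, b ≠ 2 ∧
            fderiv ℝ (v z.1) z.2 (EuclideanSpace.single 2 1) b ≠
              m z.1 (z.2 2) * fderiv ℝ (v z.1) z.2 (EuclideanSpace.single b 1) 2) →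
        ∃ s t : ℝ, s < t ∧ t < 0 ∧
          ∃ (A : EuclideanSpace ℝ (Fin 3) ≃ₗᵢ[ℝ] EuclideanSpace ℝ (Fin 3)) (b : EuclideanSpace ℝ (Fin 3))
            (O : Set (EuclideanSpace ℝ (Fin 3))), IsOpen O ∧ O.Nonempty ∧ ∀ x ∈ O, v t x = A (v s (A.symm (x - b))) := by
  intro C v hrate hcont hmild hdiv hpol W hW hWne hWs hnd _ htw _ hthick
  obtain ⟨U₁, hU₁W, hU₁o, hU₁ne, m, hm⟩ :=
    Summit.NavierStokesRegularity.NavierStokesRegularity.Theorems.PoloidalWindowDoorPoloidalWindowRigidityThickStubsOfLocalEmpty.exists_timeHeight_subwindow_of_localEmptyThick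
      hempty_thick hrate hcont hmild hdiv hpol hW hWne hWs hnd htw
  obtain ⟨z, hz, b, hb, hne⟩ := hthick m U₁ hU₁W hU₁o hU₁ne
  exact absurd (hm z hz b hb) hne

/-- **`hempty_thick ⇒ G3`** (proved, same four lines). -/
theorem congruentSemiEllipticThick_of_localEmptyThick (hempty_thick : ∀ (u : ℝ → EuclideanSpace ℝ (Fin 3) → EuclideanSpace ℝ (Fin 3))
      (U : Set (ℝ × EuclideanSpace ℝ (Fin 3))) (p₀ : ℝ × EuclideanSpace ℝ (Fin 3)),
      IsOpen U → p₀ ∈ U →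
      AnalyticOnNhd ℝ (Function.uncurry u) U →
      (∀ p ∈ U, fderiv ℝ (u p.1) p.2 (EuclideanSpace.single 0 1) 0 + fderiv ℝ (u p.1) p.2 (EuclideanSpace.single 1 1) 1 +
        fderiv ℝ (u p.1) p.2 (EuclideanSpace.single 2 1) 2 = 0) →
      (∀ p ∈ U, fderiv ℝ (u p.1) p.2 (EuclideanSpace.single 0 1) 1 = fderiv ℝ (u p.1) p.2 (EuclideanSpace.single 1 1) 0) →
      (∀ p ∈ U, fderiv ℝ (u p.1) p.2 (EuclideanSpace.single 2 1) 0 * fderiv ℝ (u p.1) p.2 (EuclideanSpace.single 1 1) 2 -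
        fderiv ℝ (u p.1) p.2 (EuclideanSpace.single 2 1) 1 * fderiv ℝ (u p.1) p.2 (EuclideanSpace.single 0 1) 2 = 0) →
      (∀ p ∈ U, ∀ j k : Fin 3,
        fderiv ℝ (fun y => deriv (fun s => u s y k) p.1 + fderiv ℝ (fun y' => u p.1 y' k) y (u p.1 y) -
            (Δ (fun y' => u p.1 y' k)) y) p.2 (EuclideanSpace.single j 1) =
          fderiv ℝ (fun y => deriv (fun s => u s y j) p.1 + fderiv ℝ (fun y' => u p.1 y' j) y (u p.1 y) -
            (Δ (fun y' => u p.1 y' j)) y) p.2 (EuclideanSpace.single k 1)) →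
      fderiv ℝ (fun y => fderiv ℝ (u p₀.1) y (EuclideanSpace.single 2 1) 2) p₀.2 (EuclideanSpace.single 0 1) *
            fderiv ℝ (u p₀.1) p₀.2 (EuclideanSpace.single 1 1) 2 -
          fderiv ℝ (fun y => fderiv ℝ (u p₀.1) y (EuclideanSpace.single 2 1) 2) p₀.2 (EuclideanSpace.single 1 1) *
            fderiv ℝ (u p₀.1) p₀.2 (EuclideanSpace.single 0 1) 2 ≠ 0 →
      (fderiv ℝ (u p₀.1) p₀.2 (EuclideanSpace.single 0 1) 2 ≠ 0 ∨ fderiv ℝ (u p₀.1) p₀.2 (EuclideanSpace.single 1 1) 2 ≠ 0) →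
      (fderiv ℝ (u p₀.1) p₀.2 (EuclideanSpace.single 2 1) 0 ≠ 0 ∨ fderiv ℝ (u p₀.1) p₀.2 (EuclideanSpace.single 2 1) 1 ≠ 0) →
      Literature.Analysis.FluidPDE.curl (u p₀.1) p₀.2 ≠ 0 →
      (fderiv ℝ (fun y =>
            (fderiv ℝ (u p₀.1) y (EuclideanSpace.single 2 1) 0 * fderiv ℝ (u p₀.1) y (EuclideanSpace.single 0 1) 2 +
                fderiv ℝ (u p₀.1) y (EuclideanSpace.single 2 1) 1 * fderiv ℝ (u p₀.1) y (EuclideanSpace.single 1 1) 2) /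
              (fderiv ℝ (u p₀.1) y (EuclideanSpace.single 0 1) 2 ^ 2 + fderiv ℝ (u p₀.1) y (EuclideanSpace.single 1 1) 2 ^ 2))
            p₀.2 (EuclideanSpace.single 0 1) ≠ 0 ∨
        fderiv ℝ (fun y =>
            (fderiv ℝ (u p₀.1) y (EuclideanSpace.single 2 1) 0 * fderiv ℝ (u p₀.1) y (EuclideanSpace.single 0 1) 2 +
                fderiv ℝ (u p₀.1) y (EuclideanSpace.single 2 1) 1 * fderiv ℝ (u p₀.1) y (EuclideanSpace.single 1 1) 2) /
              (fderiv ℝ (u p₀.1) y (EuclideanSpace.single 0 1) 2 ^ 2 + fderiv ℝ (u p₀.1) y (EuclideanSpace.single 1 1) 2 ^ 2))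
            p₀.2 (EuclideanSpace.single 1 1) ≠ 0) →
      False) :
    ∀ (C : ℝ) (v : ℝ → EuclideanSpace ℝ (Fin 3) → EuclideanSpace ℝ (Fin 3)),
      Literature.Analysis.FluidPDE.HasTypeITimeDecay C v →
      ContinuousOn (Function.uncurry v) (Set.Iio (0 : ℝ) ×ˢ Set.univ) →
      (∀ s t : ℝ, s < t → t < 0 → ∀ x, v t x =
        Literature.Analysis.UnboundedOperators.heatExtension (v s) (t - s) x -
          Literature.Analysis.FluidPDE.oseenDuhamel 1 s v v t x) →
      (∀ t < 0, Literature.Analysis.FluidPDE.VectorCalculus.IsDivFree (v t)) →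
      (∀ s < 0, ∀ y, ⟪Literature.Analysis.FluidPDE.curl (v s) y, EuclideanSpace.single 2 1⟫_ℝ = 0) →
      ∀ W : Set (ℝ × EuclideanSpace ℝ (Fin 3)), IsOpen W → W.Nonempty → W ⊆ Set.Iio (0 : ℝ) ×ˢ Set.univ →
        (∀ z ∈ W, Literature.Analysis.FluidPDE.curl (v z.1) z.2 ≠ 0 ∧
          (fderiv ℝ (v z.1) z.2 (EuclideanSpace.single 0 1) 2 ≠ 0 ∨ fderiv ℝ (v z.1) z.2 (EuclideanSpace.single 1 1) 2 ≠ 0) ∧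
          (fderiv ℝ (v z.1) z.2 (EuclideanSpace.single 2 1) 0 ≠ 0 ∨ fderiv ℝ (v z.1) z.2 (EuclideanSpace.single 2 1) 1 ≠ 0)) →
        (∀ m : ℝ → ℝ, ∀ W₁ : Set (ℝ × EuclideanSpace ℝ (Fin 3)), W₁ ⊆ W → IsOpen W₁ → W₁.Nonempty →
          ∃ z ∈ W₁, ∃ b : Fin 3, b ≠ 2 ∧
            fderiv ℝ (v z.1) z.2 (EuclideanSpace.single 2 1) b ≠
              m z.1 * fderiv ℝ (v z.1) z.2 (EuclideanSpace.single b 1) 2) →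
        (∀ z ∈ W,
          fderiv ℝ (fun x => fderiv ℝ (v z.1) x (EuclideanSpace.single 2 1) 2) z.2 (EuclideanSpace.single 0 1) *
              fderiv ℝ (v z.1) z.2 (EuclideanSpace.single 1 1) 2 -
            fderiv ℝ (fun x => fderiv ℝ (v z.1) x (EuclideanSpace.single 2 1) 2) z.2 (EuclideanSpace.single 1 1) *
              fderiv ℝ (v z.1) z.2 (EuclideanSpace.single 0 1) 2 ≠ 0) →
        ∀ a b : ℝ, W ⊆ Set.Ioo a b ×ˢ Set.univ →
          (∀ s ∈ Set.Ioo a b, ∀ y : EuclideanSpace ℝ (Fin 3),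
            0 ≤ fderiv ℝ (v s) y (EuclideanSpace.single 2 1) 0 * fderiv ℝ (v s) y (EuclideanSpace.single 0 1) 2 +
              fderiv ℝ (v s) y (EuclideanSpace.single 2 1) 1 * fderiv ℝ (v s) y (EuclideanSpace.single 1 1) 2) →
        (∀ m : ℝ → ℝ → ℝ, ∀ W₁ : Set (ℝ × EuclideanSpace ℝ (Fin 3)), W₁ ⊆ W → IsOpen W₁ → W₁.Nonempty →
          ∃ z ∈ W₁, ∃ b : Fin 3, b ≠ 2 ∧
            fderiv ℝ (v z.1) z.2 (EuclideanSpace.single 2 1) b ≠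
              m z.1 (z.2 2) * fderiv ℝ (v z.1) z.2 (EuclideanSpace.single b 1) 2) →
        ∃ s t : ℝ, s < t ∧ t < 0 ∧
          ∃ (A : EuclideanSpace ℝ (Fin 3) ≃ₗᵢ[ℝ] EuclideanSpace ℝ (Fin 3)) (b : EuclideanSpace ℝ (Fin 3))
            (O : Set (EuclideanSpace ℝ (Fin 3))), IsOpen O ∧ O.Nonempty ∧ ∀ x ∈ O, v t x = A (v s (A.symm (x - b))) := by
  intro C v hrate hcont hmild hdiv hpol W hW hWne hWs hnd _ htw _ _ _ _ hthick
  obtain ⟨U₁, hU₁W, hU₁o, hU₁ne, m, hm⟩ :=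
    Summit.NavierStokesRegularity.NavierStokesRegularity.Theorems.PoloidalWindowDoorPoloidalWindowRigidityThickStubsOfLocalEmpty.exists_timeHeight_subwindow_of_localEmptyThick
      hempty_thick hrate hcont hmild hdiv hpol hW hWne hWs hnd htw
  obtain ⟨z, hz, b, hb, hne⟩ := hthick m U₁ hU₁W hU₁o hU₁ne
  exact absurd (hm z hz b hb) hne

end Summit.NavierStokesRegularity.NavierStokesRegularity.Cruxes.PoloidalWindowRigidity.CongruenceDoor
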